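import Literature.Analysis.ODE.MeasurablePicardLindelof
import Literature.Probability.RandomPlanarGeometry.LoewnerChainProofs
import Literature.Probability.RandomPlanarGeometry.LoewnerFlow
import HarnessLib

/-!
# The real Loewner flow is a measurable functional of the driving path up to the present

Topic `Probability/RandomPlanarGeometry`. For a *family* of continuous driving functions
`W ω : ℝ≥0 → ℝ` (`ω` in a measurable space `(Ω, 𝓜)`, think of `𝓜 = 𝓕ᵂ_t`, the raw Brownian
filtration at time `t`, and `W ω = √κ B(ω)`) with `W ω 0 = 0` and `ω ↦ W ω s` measurable for every
`s ≤ t`, and a real point `x > 0`, we prove: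

* `Literature.Probability.RandomPlanarGeometry.Loewner.measurableSet_lt_swallowingTime`: the event `{ω | t < T_x(W ω)}` ("`x` is not yet
  swallowed at time `t`") is `𝓜`-measurable;
* `Literature.Probability.RandomPlanarGeometry.Loewner.measurable_realFlowTrunc`: the real flow `ω ↦ re g_t(x)[W ω] - W ω t` (set to `0`
  on `{T_x ≤ t}`) is `𝓜`-measurable.

That is, the Loewner flow of a real point and its swallowing time are functionals of the driving
path *up to the present time*, measurably — the deterministic content of "`T_x` is a stopping time
and `gₜ(x)` is adapted" (Lawler (2005), §4.1 and Ch. 6; Revuz–Yor (1999), Ch. I §4), used in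
`SLEAdaptedProofs` to discharge `Literature.Probability.RandomPlanarGeometry.isStoppingTime_swallowingStoppingTime`
(`SLEMartingale`) and for the adaptedness half of the Itô-step facts of the SLE martingales.

## Method (the truncated flow)

The Loewner field `2/(h - W_s)` is singular; its solution from `x` is *not* given by a global
Picard scheme. For `δ > 0` we use instead the **truncated field**
`F_δ(s, h) = 2 / max(h - W_s, δ)` (`Loewner.truncField`), which is bounded by `2/δ`, globally
`2/δ²`-Lipschitz in `h` and continuous in `s`, so that Mathlib's Picard–Lindelöf theorem applies on
every `[0, t]` (`isPicardLindelof_truncField`) and the solution depends measurably on the driving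
path (`MeasurablePicardLindelof.measurable_picardSolution`, the path being stopped at `t`). The
truncated and true flows are then compared path by path:

* if the true flow `gₛ(x)` stays `δ`-away from `W` on `[0, t]`, it solves the truncated equation,
  hence equals the truncated solution there (`truncSol_eq_re_of_far`, Grönwall uniqueness);
* if a truncated solution stays `2δ`-away from `W` on `[0, t]`, it solves the true equation, so
  `t < T_x` by the extension criterion `IsSolution.coe_lt_swallowingTime_of_le_norm_sub` of
  `LoewnerChainProofs` (`lt_swallowingTime_of_truncSol_far`);

whence `{t < T_x} = ⋃ₙ ⋂_{q ∈ ℚ ∩ [0,t]} {h^{1/(n+1)}_q - W_q ≥ 2/(n+1)}` (a countable Boolean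
combination of measurable events; rational times suffice by continuity) and on it
`gₜ(x) = limₙ h^{1/(n+1)}_t` (eventually constant).

## References

* G. F. Lawler, *Conformally Invariant Processes in the Plane* (2005), §4.1 (the flow of real
  points, `T_x`), §6.2.
* D. Revuz, M. Yor, *Continuous Martingales and Brownian Motion* (1999), Ch. I §4 (hitting times
  of adapted continuous processes), Ch. IX §1.
* D. W. Stroock, S. R. S. Varadhan, *Multidimensional Diffusion Processes* (1979), §1.1.
-/

noncomputable section

open Set Filter Topology MeasureTheory Metric Complex
open scoped NNReal

namespace Literature.Probability.RandomPlanarGeometry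

namespace Loewner

/-! ### The truncated Loewner field -/

section TruncField

variable (W : ℝ≥0 → ℝ) (δ : ℝ)

/-- The **truncated real Loewner field** `F_δ(s, h) = 2 / max(h - W_s, δ)`: it agrees with the
chordal Loewner field `2/(h - W_s)` wherever `h - W_s ≥ δ`, and is bounded (`≤ 2/δ`) and globally
Lipschitz (`2/δ²`) in `h` for `δ > 0`. Time `s : ℝ` is clamped to `ℝ≥0` as in
`Loewner.vectorField`. A technical device for measurability (no claim of provenance). [folklore] -/
def truncField (s h : ℝ) : ℝ :=
  2 / max (h - W s.toNNReal) δ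

variable {W δ}

/-- Unfolding of `truncField`. [folklore] -/
theorem truncField_apply (s h : ℝ) : truncField W δ s h = 2 / max (h - W s.toNNReal) δ := rfl

/-- Where `h - W_s ≥ δ` the truncated field is the Loewner field `2/(h - W_s)`. [folklore] -/
theorem truncField_of_le {s h : ℝ} (h1 : δ ≤ h - W s.toNNReal) :
    truncField W δ s h = 2 / (h - W s.toNNReal) := by
  rw [truncField, max_eq_left h1]

/-- The truncated field is bounded by `2/δ` (`δ > 0`). [folklore] -/
theorem abs_truncField_le (hδ : 0 < δ) (s h : ℝ) : |truncField W δ s h| ≤ 2 / δ := by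
  have hm : δ ≤ max (h - W s.toNNReal) δ := le_max_right _ _
  have hm0 : 0 < max (h - W s.toNNReal) δ := hδ.trans_le hm
  rw [truncField, abs_of_pos (div_pos two_pos hm0)]
  exact div_le_div_of_nonneg_left zero_le_two hδ hm

/-- The truncated field is nonnegative (`δ > 0`). [folklore] -/
theorem truncField_nonneg (hδ : 0 < δ) (s h : ℝ) : 0 ≤ truncField W δ s h :=
  div_nonneg zero_le_two (hδ.le.trans (le_max_right _ _))

/-- The truncated field is globally `2/δ²`-Lipschitz in the space variable (`δ > 0`). [folklore] -/
theorem lipschitzWith_truncField (hδ : 0 < δ) (s : ℝ) :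
    LipschitzWith (2 / δ ^ 2).toNNReal (truncField W δ s) := by
  refine LipschitzWith.of_dist_le_mul fun h₁ h₂ ↦ ?_
  rw [Real.coe_toNNReal _ (by positivity)]
  set m₁ := max (h₁ - W s.toNNReal) δ with hm₁
  set m₂ := max (h₂ - W s.toNNReal) δ with hm₂
  have h1 : δ ≤ m₁ := le_max_right _ _
  have h2 : δ ≤ m₂ := le_max_right _ _
  have h10 : 0 < m₁ := hδ.trans_le h1
  have h20 : 0 < m₂ := hδ.trans_le h2
  have hmm : |m₁ - m₂| ≤ |h₁ - h₂| := by
    have := abs_max_sub_max_le_abs (h₁ - W s.toNNReal) (h₂ - W s.toNNReal) δ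
    rwa [show h₁ - W s.toNNReal - (h₂ - W s.toNNReal) = h₁ - h₂ by ring] at this
  rw [Real.dist_eq, Real.dist_eq, truncField, truncField, ← hm₁, ← hm₂,
    div_sub_div _ _ h10.ne' h20.ne', abs_div, abs_of_pos (mul_pos h10 h20)]
  rw [show 2 * m₂ - m₁ * 2 = 2 * (m₂ - m₁) by ring, abs_mul, abs_two, abs_sub_comm]
  rw [div_le_iff₀ (mul_pos h10 h20)]
  calc 2 * |m₁ - m₂| ≤ 2 * |h₁ - h₂| := by linarith
    _ = 2 / δ ^ 2 * |h₁ - h₂| * (δ * δ) := by field_simp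
    _ ≤ 2 / δ ^ 2 * |h₁ - h₂| * (m₁ * m₂) := by
        apply mul_le_mul_of_nonneg_left (mul_le_mul h1 h2 hδ.le h10.le)
        positivity

/-- The truncated field is continuous in time (continuous driving function, `δ > 0`). [folklore] -/
theorem continuous_truncField_left (hW : Continuous W) (hδ : 0 < δ) (h : ℝ) :
    Continuous fun s ↦ truncField W δ s h := by
  unfold truncField
  refine continuous_const.div ((continuous_const.sub (hW.comp continuous_real_toNNReal)).max
    continuous_const) fun s ↦ (hδ.trans_le (le_max_right _ _)).ne'

/-- The truncated field is jointly continuous (continuous driving function, `δ > 0`). [folklore] -/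
theorem continuous_truncField_uncurry (hW : Continuous W) (hδ : 0 < δ) :
    Continuous (Function.uncurry (truncField W δ)) := by
  unfold truncField Function.uncurry
  refine continuous_const.div (((continuous_snd).sub
    (hW.comp (continuous_real_toNNReal.comp continuous_fst))).max continuous_const)
    fun p ↦ (hδ.trans_le (le_max_right _ _)).ne'

/-- **Picard–Lindelöf hypotheses for the truncated field** on `[0, T]` from any initial value `x`
(radius of initial data `r = 0`): Lipschitz constant `2/δ²`, bound `2/δ`, ball radius
`2T/δ + 1`. [folklore] -/
theorem isPicardLindelof_truncField (hW : Continuous W) (hδ : 0 < δ) {T : ℝ} (hT : 0 ≤ T) (x : ℝ) :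
    IsPicardLindelof (truncField W δ) (⟨0, le_rfl, hT⟩ : Icc (0 : ℝ) T) x
      (2 / δ * T + 1).toNNReal 0 (2 / δ).toNNReal (2 / δ ^ 2).toNNReal where
  lipschitzOnWith s _ := (lipschitzWith_truncField hδ s).lipschitzOnWith
  continuousOn h _ := (continuous_truncField_left hW hδ h).continuousOn
  norm_le s _ h _ := by
    rw [Real.norm_eq_abs, Real.coe_toNNReal _ (by positivity)]
    exact abs_truncField_le hδ s h
  mul_max_le := by
    rw [Real.coe_toNNReal _ (by positivity), Real.coe_toNNReal _ (by positivity), NNReal.coe_zero]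
    have hmax : max (T - (0 : ℝ)) ((0 : ℝ) - 0) = T := by
      rw [sub_zero, sub_self, max_eq_left hT]
    calc 2 / δ * max (T - (0 : ℝ)) ((0 : ℝ) - 0) = 2 / δ * T := by rw [hmax]
      _ ≤ 2 / δ * T + 1 - 0 := by linarith

end TruncField

/-! ### Comparison of truncated and true flows along one path -/

section Compare

variable {W : ℝ≥0 → ℝ} {δ : ℝ} {x : ℝ} {h : ℝ → ℝ} {T : ℝ≥0}

/-- A solution of the truncated equation that stays `2δ`-away from the driving function on
`[0, T]` solves the true Loewner equation there: the complexified curve is an `IsSolution` with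
lifetime `T`. [folklore] -/
theorem isSolution_of_truncSol_far (hδ : 0 < δ) (h0 : h 0 = x)
    (hder : ∀ s ∈ Icc (0 : ℝ) T, HasDerivWithinAt h (truncField W δ s (h s)) (Icc (0 : ℝ) T) s)
    (hfar : ∀ s ∈ Icc (0 : ℝ) T, 2 * δ ≤ h s - W s.toNNReal) :
    IsSolution W x (fun s ↦ ((h s : ℝ) : ℂ)) T := by
  refine ⟨by simp [h0], fun s hs ↦ ?_, fun s hs0 hsT heq ↦ ?_⟩
  · obtain ⟨hs0, hsT⟩ := (mem_timeDomain_coe_iff (b := T)).1 hs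
    have hsI : s ∈ Icc (0 : ℝ) T := ⟨hs0, hsT.le⟩
    have h1 := (hder s hsI).ofReal_comp
    have hfar1 : δ ≤ h s - W s.toNNReal := by linarith [hfar s hsI]
    rw [truncField_of_le hfar1] at h1
    have h2 : vectorField W s ((h s : ℝ) : ℂ) = (((2 / (h s - W s.toNNReal) : ℝ)) : ℂ) := by
      rw [vectorField_apply]
      push_cast
      rfl
    rw [h2]
    refine h1.mono fun u hu ↦ ?_
    obtain ⟨hu0, huT⟩ := (mem_timeDomain_coe_iff (b := T)).1 hu
    exact ⟨hu0, huT.le⟩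
  · have hsT' : s < T := ((mem_timeDomain_coe_iff (b := T)).1 ⟨hs0, hsT⟩).2
    have h1 := hfar s ⟨hs0, hsT'.le⟩
    have heq' : ((h s : ℝ) : ℂ) = (W s.toNNReal : ℂ) := heq
    have h2 : h s = W s.toNNReal := by exact_mod_cast heq'
    linarith

/-- **If a truncated solution stays `2δ`-away from the driving function on `[0, T]` (`T > 0`), then
`x` is not swallowed by time `T`**: `T < T_x`, and the true flow at every time `s ∈ [0, T]` is the
truncated solution, `re (map W s x) = h s`. (Extension criterion
`IsSolution.coe_lt_swallowingTime_of_le_norm_sub` and `map_eq_of_isSolution`.) [folklore] -/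
theorem lt_swallowingTime_of_truncSol_far (hW : Continuous W) (hδ : 0 < δ) (hT : 0 < T)
    (h0 : h 0 = x)
    (hder : ∀ s ∈ Icc (0 : ℝ) T, HasDerivWithinAt h (truncField W δ s (h s)) (Icc (0 : ℝ) T) s)
    (hfar : ∀ s ∈ Icc (0 : ℝ) T, 2 * δ ≤ h s - W s.toNNReal) :
    (T : WithTop ℝ≥0) < swallowingTime W x := by
  have hsol := isSolution_of_truncSol_far hδ h0 hder hfar
  refine hsol.coe_lt_swallowingTime_of_le_norm_sub hW hT (δ := ⟨2 * δ, by positivity⟩)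
    (by exact_mod_cast (by positivity : 0 < 2 * δ)) fun s hs0 hsT ↦ ?_
  have h1 := hfar s ⟨hs0, hsT.le⟩
  have h2 : ((h s : ℝ) : ℂ) - (W s.toNNReal : ℂ) = ((h s - W s.toNNReal : ℝ) : ℂ) := by push_cast; ring
  rw [h2, Complex.norm_real, Real.norm_eq_abs]
  exact h1.trans (le_abs_self _)

/-- Under the hypotheses of `lt_swallowingTime_of_truncSol_far`, the true flow on `[0, T)` is the
truncated solution: `re (map W s x) = h s` for `s < T`. [folklore] -/
theorem re_map_eq_of_truncSol_far (hW : Continuous W) (hδ : 0 < δ) (h0 : h 0 = x)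
    (hder : ∀ s ∈ Icc (0 : ℝ) T, HasDerivWithinAt h (truncField W δ s (h s)) (Icc (0 : ℝ) T) s)
    (hfar : ∀ s ∈ Icc (0 : ℝ) T, 2 * δ ≤ h s - W s.toNNReal) {s : ℝ≥0} (hs : s < T) :
    (map W s x).re = h s := by
  have hsol := isSolution_of_truncSol_far hδ h0 hder hfar
  rw [map_eq_of_isSolution hW hsol (by exact_mod_cast hs), ofReal_re]

/-- **If the true flow stays `δ`-away from the driving function on `[0, T]`, it is the truncated
solution there**: for the maximal solution `g` from `x` (alive through `T`) with
`re g_s - W_s ≥ δ` on `[0, T]`, and any solution `h` of the truncated equation from `x` on `[0, T]`,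
`h = re ∘ g` on `[0, T]` (both solve the truncated, globally Lipschitz, equation: Grönwall
uniqueness, Mathlib `ODE_solution_unique_of_mem_Icc_right`). [folklore] -/
theorem truncSol_eq_re_of_far (hδ : 0 < δ) {g : ℝ → ℂ} {Tg : WithTop ℝ≥0}
    (hg : IsSolution W x g Tg) (hTg : (T : WithTop ℝ≥0) < Tg)
    (hgfar : ∀ s ∈ Icc (0 : ℝ) T, δ ≤ (g s).re - W s.toNNReal) (h0 : h 0 = x)
    (hder : ∀ s ∈ Icc (0 : ℝ) T, HasDerivWithinAt h (truncField W δ s (h s)) (Icc (0 : ℝ) T) s) :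
    EqOn h (fun s ↦ (g s).re) (Icc (0 : ℝ) T) := by
  have hTg' : (((T : ℝ).toNNReal : ℝ≥0) : WithTop ℝ≥0) < Tg := by simpa using hTg
  have hsub := Icc_subset_timeDomain hTg'
  have him : ∀ s ∈ Icc (0 : ℝ) T, (g s).im = 0 := fun s hs ↦
    IsSolution.im_eq_zero_holds hg (ofReal_im x) s hs.1 (hsub hs).2
  -- `re ∘ g` solves the truncated equation on `[0, T]`
  have hgder : ∀ s ∈ Ico (0 : ℝ) T, HasDerivWithinAt (fun u ↦ (g u).re)
      (truncField W δ s ((g s).re)) (Ici s) s := by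
    intro s hs
    have h1 := hg.hasDerivWithinAt_Ici hsub s hs
    have h2 : HasDerivWithinAt (fun u ↦ (g u).re) (reCLM (vectorField W s (g s))) (Ici s) s :=
      reCLM.hasFDerivAt.comp_hasDerivWithinAt s h1
    rw [reCLM_apply, re_vectorField_of_im_eq_zero W s (him s (Ico_subset_Icc_self hs)),
      ← truncField_of_le (hgfar s (Ico_subset_Icc_self hs))] at h2
    exact h2
  have hhder : ∀ s ∈ Ico (0 : ℝ) T, HasDerivWithinAt h (truncField W δ s (h s)) (Ici s) s :=
    fun s hs ↦ (hder s (Ico_subset_Icc_self hs)).mono_of_mem_nhdsWithin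
      (mem_of_superset (Icc_mem_nhdsGE hs.2) (Icc_subset_Icc hs.1 le_rfl))
  have hhcont : ContinuousOn h (Icc (0 : ℝ) T) := fun s hs ↦ (hder s hs).continuousWithinAt
  have hgcont : ContinuousOn (fun u ↦ (g u).re) (Icc (0 : ℝ) T) :=
    continuous_re.comp_continuousOn (hg.continuousOn.mono hsub)
  refine ODE_solution_unique_of_mem_Icc_right (v := truncField W δ) (s := fun _ ↦ univ)
    (K := (2 / δ ^ 2).toNNReal) (fun s _ ↦ (lipschitzWith_truncField hδ s).lipschitzOnWith)
    hhcont hhder (fun _ _ ↦ mem_univ _) hgcont hgder (fun _ _ ↦ mem_univ _) ?_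
  rw [h0, hg.apply_zero, ofReal_re]

/-- **Rational times suffice**: if a continuous function is `≥ c` at all rational points of
`[0, T]`, it is `≥ c` on `[0, T]`. [folklore] -/
theorem forall_Icc_le_of_forall_rat {F : ℝ → ℝ} (hF : Continuous F) {c : ℝ} {T : ℝ} (hT : 0 ≤ T)
    (h : ∀ q : ℚ, (q : ℝ) ∈ Icc (0 : ℝ) T → c ≤ F q) : ∀ s ∈ Icc (0 : ℝ) T, c ≤ F s := by
  intro s hs
  by_contra hlt
  rw [not_le] at hlt
  -- the open set `{φ < c}` meets `[0, T]` at `s`, hence meets `(0, T)` or `s` is `0 = T`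
  rcases hT.eq_or_lt with hT0 | hT0
  · have hs0 : s = 0 := le_antisymm (hT0 ▸ hs.2) hs.1
    have := h 0 (by simp [hT])
    rw [Rat.cast_zero, ← hs0] at this
    linarith
  have hopen : IsOpen {u : ℝ | F u < c} := isOpen_lt hF continuous_const
  obtain ⟨ε, hε, hball⟩ := Metric.isOpen_iff.1 hopen s hlt
  -- a point of `(0, T)` within `ε` of `s`
  obtain ⟨u, hu, hus⟩ : ∃ u ∈ Ioo (0 : ℝ) T, dist u s < ε := by
    have hsc : s ∈ closure (Ioo (0 : ℝ) T) := by rw [closure_Ioo hT0.ne]; exact hs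
    obtain ⟨u, hu1, hu2⟩ := Metric.mem_closure_iff.1 hsc ε hε
    exact ⟨u, hu1, by rwa [dist_comm]⟩
  -- a rational in the open set `Ioo 0 T ∩ ball s ε`
  have hopen' : IsOpen (Ioo (0 : ℝ) T ∩ ball s ε) := isOpen_Ioo.inter isOpen_ball
  obtain ⟨q, hq⟩ := Rat.denseRange_cast.exists_mem_open hopen' ⟨u, hu, hus⟩
  have h1 := h q ⟨hq.1.1.le, hq.1.2.le⟩
  have h2 : F q < c := hball hq.2
  linarith

end Compare


/-! ### A measurable family of driving paths: the truncated flow is measurable -/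

section Parametrised

variable {Ω : Type*} {mΩ : MeasurableSpace Ω} (W : Ω → ℝ≥0 → ℝ) (t : ℝ≥0)

/-- The driving path **stopped at time `t`**: `s ↦ W ω (s ∧ t)`. It agrees with `W ω` on `[0, t]`
and each of its values is a value of `W ω` at a time `≤ t` (so it is measurable with respect to
"the information up to time `t`" as soon as `W` is adapted). [folklore] -/
def stoppedPath (ω : Ω) : ℝ≥0 → ℝ := fun s ↦ W ω (min s t)

variable {W t}

/-- On `[0, t]` the stopped path is the path. [folklore] -/
theorem stoppedPath_of_le {ω : Ω} {s : ℝ≥0} (hs : s ≤ t) : stoppedPath W t ω s = W ω s := by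
  rw [stoppedPath, min_eq_left hs]

/-- The stopped path starts where the path starts. [folklore] -/
theorem stoppedPath_zero (ω : Ω) : stoppedPath W t ω 0 = W ω 0 :=
  stoppedPath_of_le (zero_le : (0 : ℝ≥0) ≤ t)

/-- The stopped path of a continuous path is continuous. [folklore] -/
theorem continuous_stoppedPath {ω : Ω} (hc : Continuous (W ω)) : Continuous (stoppedPath W t ω) :=
  hc.comp (continuous_id.min continuous_const)

/-- Each value of the stopped path is measurable, if the values of the path at times `≤ t` are.
[folklore] -/
theorem measurable_stoppedPath (hmeas : ∀ s, s ≤ t → Measurable fun ω ↦ W ω s) (s : ℝ≥0) :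
    Measurable fun ω ↦ stoppedPath W t ω s :=
  hmeas (min s t) (min_le_right _ _)

/-- The stopped path is jointly measurable in `(ω, time)` (continuous paths, measurable values).
[folklore] -/
theorem measurable_stoppedPath_uncurry (hc : ∀ ω, Continuous (W ω))
    (hmeas : ∀ s, s ≤ t → Measurable fun ω ↦ W ω s) :
    Measurable fun p : Ω × ℝ ↦ stoppedPath W t p.1 p.2.toNNReal := by
  have h1 : Measurable (Function.uncurry fun (τ : ℝ) (ω : Ω) ↦ stoppedPath W t ω τ.toNNReal) :=
    measurable_uncurry_of_continuous_of_measurable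
      (fun ω ↦ (continuous_stoppedPath (hc ω)).comp continuous_real_toNNReal)
      fun τ ↦ measurable_stoppedPath hmeas _
  exact h1.comp measurable_swap

/-- The truncated fields of the stopped paths are jointly measurable in `(ω, time, space)`.
[folklore] -/
theorem measurable_truncField_stoppedPath (hc : ∀ ω, Continuous (W ω))
    (hmeas : ∀ s, s ≤ t → Measurable fun ω ↦ W ω s) (δ : ℝ) :
    Measurable fun p : Ω × ℝ × ℝ ↦ truncField (stoppedPath W t p.1) δ p.2.1 p.2.2 := by
  unfold truncField
  have h1 : Measurable fun p : Ω × ℝ × ℝ ↦ stoppedPath W t p.1 p.2.1.toNNReal :=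
    (measurable_stoppedPath_uncurry hc hmeas).comp (measurable_fst.prodMk (measurable_snd.fst))
  exact measurable_const.div ((measurable_snd.snd.sub h1).max measurable_const)

/-- The Picard–Lindelöf hypotheses for the truncated fields of the stopped paths, uniformly in
`ω` (`isPicardLindelof_truncField`). [folklore] -/
theorem isPicardLindelof_truncField_stoppedPath (hc : ∀ ω, Continuous (W ω)) {δ : ℝ} (hδ : 0 < δ)
    (x : ℝ) (ω : Ω) :
    IsPicardLindelof (truncField (stoppedPath W t ω) δ) (⟨0, le_rfl, t.coe_nonneg⟩ : Icc (0 : ℝ) t)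
      x (2 / δ * t + 1).toNNReal 0 (2 / δ).toNNReal (2 / δ ^ 2).toNNReal :=
  isPicardLindelof_truncField (continuous_stoppedPath (hc ω)) hδ t.coe_nonneg x

/-- **The truncated flow** `h^δ : Ω → ℝ → ℝ`: for each `ω`, the solution on `[0, t]` of
`ḣ = 2/max(h - W ω, δ)`, `h(0) = x` (driving path stopped at `t`), chosen by the Picard scheme
(`Literature.Analysis.ODE.picardSolution`), hence measurable in `ω` at each time (`measurable_truncFlow`). [folklore] -/
def truncFlow (hc : ∀ ω, Continuous (W ω)) {δ : ℝ} (hδ : 0 < δ) (x : ℝ) : Ω → ℝ → ℝ :=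
  Literature.Analysis.ODE.picardSolution (isPicardLindelof_truncField_stoppedPath (W := W) (t := t) hc hδ x)
    (mem_closedBall_self le_rfl)

/-- The truncated flow starts at `x`. [folklore] -/
theorem truncFlow_zero (hc : ∀ ω, Continuous (W ω)) {δ : ℝ} (hδ : 0 < δ) (x : ℝ) (ω : Ω) :
    truncFlow (t := t) hc hδ x ω 0 = x :=
  (Literature.Analysis.ODE.picardSolution_spec (isPicardLindelof_truncField_stoppedPath (W := W) (t := t) hc hδ x)
    (mem_closedBall_self le_rfl) ω).1

/-- The truncated flow solves the truncated Loewner equation of the (unstopped) path on `[0, t]`.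
[folklore] -/
theorem hasDerivWithinAt_truncFlow (hc : ∀ ω, Continuous (W ω)) {δ : ℝ} (hδ : 0 < δ) (x : ℝ)
    (ω : Ω) {s : ℝ} (hs : s ∈ Icc (0 : ℝ) t) :
    HasDerivWithinAt (truncFlow (t := t) hc hδ x ω)
      (truncField (W ω) δ s (truncFlow (t := t) hc hδ x ω s)) (Icc (0 : ℝ) t) s := by
  have h := (Literature.Analysis.ODE.picardSolution_spec (isPicardLindelof_truncField_stoppedPath (W := W) (t := t) hc hδ x)
    (mem_closedBall_self le_rfl) ω).2 s hs
  refine h.congr_deriv ?_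
  simp only [truncFlow, truncField]
  rw [stoppedPath_of_le ((Real.toNNReal_le_iff_le_coe).2 hs.2)]

/-- The truncated flow is continuous in time. [folklore] -/
theorem continuous_truncFlow (hc : ∀ ω, Continuous (W ω)) {δ : ℝ} (hδ : 0 < δ) (x : ℝ) (ω : Ω) :
    Continuous (truncFlow (t := t) hc hδ x ω) :=
  Literature.Analysis.ODE.continuous_picardSolution _ _ ω

/-- **The truncated flow is measurable in `ω`** at each time, when the path values at times `≤ t`
are measurable (`MeasurablePicardLindelof.measurable_picardSolution`). [folklore] -/
theorem measurable_truncFlow (hc : ∀ ω, Continuous (W ω))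
    (hmeas : ∀ s, s ≤ t → Measurable fun ω ↦ W ω s) {δ : ℝ} (hδ : 0 < δ) (x : ℝ) (s : ℝ) :
    Measurable fun ω ↦ truncFlow (t := t) hc hδ x ω s :=
  Literature.Analysis.ODE.measurable_picardSolution _ _ (measurable_truncField_stoppedPath hc hmeas δ) s

/-! ### `{t < T_x}` is measurable and the flow is measurable on it -/

/-- The truncation levels `δₙ = 1/(n+1)` are positive. [folklore] -/
theorem one_div_succ_pos (n : ℕ) : (0 : ℝ) < 1 / (n + 1) := Nat.one_div_pos_of_nat

/-- **Key identification along one path** (`t < T_x(W ω)`): if the true flow is `m`-far from the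
driving function on `[0, t]` and `1/(n+1) ≤ m`, then the truncated flow at level `1/(n+1)` is the
true flow on `[0, t]`. [folklore] -/
theorem truncFlow_eq_re (hc : ∀ ω, Continuous (W ω)) {x : ℝ} (ω : Ω) {g : ℝ → ℂ}
    (hg : IsSolution (W ω) x g (swallowingTime (W ω) x))
    (ht : (t : WithTop ℝ≥0) < swallowingTime (W ω) x) {m : ℝ} (n : ℕ) (hnm : 1 / (n + 1 : ℝ) ≤ m)
    (hgfar : ∀ s ∈ Icc (0 : ℝ) t, m ≤ (g s).re - W ω s.toNNReal) :
    EqOn (truncFlow (t := t) hc (one_div_succ_pos n) x ω) (fun s ↦ (g s).re) (Icc (0 : ℝ) t) :=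
  truncSol_eq_re_of_far (one_div_succ_pos n) hg ht (fun s hs ↦ hnm.trans (hgfar s hs))
    (truncFlow_zero hc _ x ω) fun _ hs ↦ hasDerivWithinAt_truncFlow hc _ x ω hs

/-- Along one path with `t < T_x` (`x > W ω 0`): the true flow is `m`-far from the driving function
on `[0, t]` for some `m > 0`. [folklore] -/
theorem exists_far_of_lt_swallowingTime (hc : ∀ ω, Continuous (W ω)) {x : ℝ} (ω : Ω)
    (hx : W ω 0 < x) {g : ℝ → ℂ} (hg : IsSolution (W ω) x g (swallowingTime (W ω) x))
    (ht : (t : WithTop ℝ≥0) < swallowingTime (W ω) x) :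
    ∃ m : ℝ, 0 < m ∧ ∀ s ∈ Icc (0 : ℝ) t, m ≤ (g s).re - W ω s.toNNReal := by
  have ht' : (((t : ℝ).toNNReal : ℝ≥0) : WithTop ℝ≥0) < swallowingTime (W ω) x := by simpa using ht
  obtain ⟨m, hm, hfar⟩ := hg.exists_le_norm_sub (hc ω) t.coe_nonneg ht'
  have hsub := Icc_subset_timeDomain ht'
  refine ⟨m, hm, fun s hs ↦ ?_⟩
  have him : (g s).im = 0 := IsSolution.im_eq_zero_holds hg (ofReal_im x) s hs.1 (hsub hs).2
  have hpos : 0 < (g s).re - W ω s.toNNReal :=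
    sub_pos.2 (hg.driving_lt_re (hc ω) hx hs.1 (hsub hs).2)
  have := hfar s hs
  rwa [norm_sub_driving_of_im_eq_zero him, abs_of_pos hpos] at this

variable (W t) in
/-- The measurable description of `{t < T_x}`: the `n`-th approximating event "the truncated flow
at level `1/(n+1)` stays `2/(n+1)`-away from the driving function at all rational times of
`[0, t]`". [folklore] -/
def farEvent (hc : ∀ ω, Continuous (W ω)) (x : ℝ) (n : ℕ) : Set Ω :=
  ⋂ q : ℚ, {ω | (q : ℝ) ∈ Icc (0 : ℝ) t →
    2 * (1 / (n + 1 : ℝ)) ≤ truncFlow (t := t) hc (one_div_succ_pos n) x ω q - W ω (q : ℝ).toNNReal}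

/-- The approximating events are measurable (countable intersections of measurable events).
[folklore] -/
theorem measurableSet_farEvent (hc : ∀ ω, Continuous (W ω))
    (hmeas : ∀ s, s ≤ t → Measurable fun ω ↦ W ω s) (x : ℝ) (n : ℕ) :
    MeasurableSet (farEvent W t hc x n) := by
  refine MeasurableSet.iInter fun q ↦ ?_
  by_cases hq : (q : ℝ) ∈ Icc (0 : ℝ) t
  · have hqt : (q : ℝ).toNNReal ≤ t := (Real.toNNReal_le_iff_le_coe).2 hq.2
    have hm : Measurable fun ω ↦ truncFlow (t := t) hc (one_div_succ_pos n) x ω q -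
        W ω (q : ℝ).toNNReal :=
      (measurable_truncFlow hc hmeas _ x _).sub (hmeas _ hqt)
    have : {ω | (q : ℝ) ∈ Icc (0 : ℝ) t → 2 * (1 / (n + 1 : ℝ)) ≤
        truncFlow (t := t) hc (one_div_succ_pos n) x ω q - W ω (q : ℝ).toNNReal} =
        {ω | 2 * (1 / (n + 1 : ℝ)) ≤
          truncFlow (t := t) hc (one_div_succ_pos n) x ω q - W ω (q : ℝ).toNNReal} := by
      ext ω; simp [hq]
    rw [this]
    exact measurableSet_le measurable_const hm
  · have : {ω | (q : ℝ) ∈ Icc (0 : ℝ) t → 2 * (1 / (n + 1 : ℝ)) ≤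
        truncFlow (t := t) hc (one_div_succ_pos n) x ω q - W ω (q : ℝ).toNNReal} = univ := by
      ext ω; simp only [mem_setOf_eq, mem_univ, iff_true]; exact fun h ↦ absurd h hq
    rw [this]
    exact MeasurableSet.univ

/-- **`{t < T_x} = ⋃ₙ farEvent n`** for `x > 0 = W ω 0` and `t > 0`: (⊆) the true flow is `m`-far
on `[0, t]`, and for `2/(n+1) ≤ m` the truncated flow equals it; (⊇) by continuity the truncated
flow is `2/(n+1)`-far at *all* times of `[0, t]`, hence solves the true equation and `t < T_x`
(`lt_swallowingTime_of_truncSol_far`). [folklore] -/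
theorem setOf_lt_swallowingTime_eq_iUnion (hc : ∀ ω, Continuous (W ω)) (h0 : ∀ ω, W ω 0 = 0)
    {x : ℝ} (hx : 0 < x) (ht : 0 < t) :
    {ω | (t : WithTop ℝ≥0) < swallowingTime (W ω) x} = ⋃ n, farEvent W t hc x n := by
  ext ω
  simp only [mem_setOf_eq, mem_iUnion]
  have hx' : W ω 0 < x := by rw [h0]; exact hx
  have hx0 : (x : ℂ) ≠ W ω 0 := fun h ↦ hx'.ne' (by exact_mod_cast h)
  constructor
  · intro hlt
    obtain ⟨g, hg⟩ := exists_isSolution_swallowingTime_holds (hc ω) hx0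
    obtain ⟨m, hm, hfar⟩ := exists_far_of_lt_swallowingTime hc ω hx' hg hlt
    obtain ⟨n, hn⟩ := exists_nat_one_div_lt (half_pos hm)
    refine ⟨n, mem_iInter.2 fun q hq ↦ ?_⟩
    have hnm : 1 / (n + 1 : ℝ) ≤ m := by linarith
    rw [truncFlow_eq_re hc ω hg hlt n hnm hfar hq]
    linarith [hfar q hq]
  · rintro ⟨n, hn⟩
    have hn' := mem_iInter.1 hn
    have hcontF : Continuous fun s ↦ truncFlow (t := t) hc (one_div_succ_pos n) x ω s -
        W ω s.toNNReal :=
      (continuous_truncFlow hc _ x ω).sub ((hc ω).comp continuous_real_toNNReal)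
    have hall := forall_Icc_le_of_forall_rat hcontF t.coe_nonneg fun q hq ↦ hn' q hq
    exact lt_swallowingTime_of_truncSol_far (hc ω) (one_div_succ_pos n) ht (truncFlow_zero hc _ x ω)
      (fun s hs ↦ hasDerivWithinAt_truncFlow hc _ x ω hs) hall

/-- **The event `{t < T_x}` is measurable** with respect to any σ-algebra for which the driving
path values at times `≤ t` are measurable (continuous paths with `W ω 0 = 0`, real `x > 0`): "`x`
is not yet swallowed" is decided by the path up to time `t`, measurably. Lawler (2005), §4.1;
Revuz–Yor (1999), Ch. I §4. [cite: Lawler2005, Ch. 4 §4.1] -/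
theorem measurableSet_lt_swallowingTime (hc : ∀ ω, Continuous (W ω)) (h0 : ∀ ω, W ω 0 = 0)
    (hmeas : ∀ s, s ≤ t → Measurable fun ω ↦ W ω s) {x : ℝ} (hx : 0 < x) :
    MeasurableSet {ω | (t : WithTop ℝ≥0) < swallowingTime (W ω) x} := by
  rcases (zero_le : (0 : ℝ≥0) ≤ t).eq_or_lt with ht | ht
  · have : {ω | (t : WithTop ℝ≥0) < swallowingTime (W ω) x} = univ := by
      refine eq_univ_of_forall fun ω ↦ ?_
      rw [mem_setOf_eq, ← ht]
      exact swallowingTime_pos_holds (hc ω) (fun h ↦ hx.ne' (by rw [h0 ω] at h; exact_mod_cast h))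
    rw [this]
    exact MeasurableSet.univ
  · rw [setOf_lt_swallowingTime_eq_iUnion hc h0 hx ht]
    exact MeasurableSet.iUnion fun n ↦ measurableSet_farEvent hc hmeas x n

/-- **The real Loewner flow is a measurable functional of the path up to the present**: the map
`ω ↦ re g_t(x)[W ω] - W ω t` on `{t < T_x}` (and `0` elsewhere) is measurable with respect to any
σ-algebra making the path values at times `≤ t` measurable (continuous paths, `W ω 0 = 0`,
`x > 0`). On `{t < T_x}` it is the (eventually stationary) limit of the measurable truncated flows.
Lawler (2005), §4.1. [cite: Lawler2005, Ch. 4 §4.1] -/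
theorem measurable_realFlowTrunc (hc : ∀ ω, Continuous (W ω)) (h0 : ∀ ω, W ω 0 = 0)
    (hmeas : ∀ s, s ≤ t → Measurable fun ω ↦ W ω s) {x : ℝ} (hx : 0 < x) :
    Measurable fun ω ↦ if (t : WithTop ℝ≥0) < swallowingTime (W ω) x then
      (map (W ω) t x).re - W ω t else 0 := by
  classical
  set E := {ω | (t : WithTop ℝ≥0) < swallowingTime (W ω) x} with hE
  have hEm : MeasurableSet E := measurableSet_lt_swallowingTime hc h0 hmeas hx
  set G : ℕ → Ω → ℝ := fun n ω ↦ if ω ∈ E then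
    truncFlow (t := t) hc (one_div_succ_pos n) x ω t - W ω t else 0 with hG
  have hGm : ∀ n, Measurable (G n) := fun n ↦
    Measurable.ite hEm ((measurable_truncFlow hc hmeas _ x _).sub (hmeas t le_rfl)) measurable_const
  refine measurable_of_tendsto_metrizable hGm (tendsto_pi_nhds.2 fun ω ↦ ?_)
  by_cases hω : ω ∈ E
  · have hlt : (t : WithTop ℝ≥0) < swallowingTime (W ω) x := hω
    simp only [hG, if_pos hω, if_pos hlt]
    have hx' : W ω 0 < x := by rw [h0]; exact hx
    have hx0 : (x : ℂ) ≠ W ω 0 := fun h ↦ hx'.ne' (by exact_mod_cast h)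
    obtain ⟨g, hg⟩ := exists_isSolution_swallowingTime_holds (hc ω) hx0
    obtain ⟨m, hm, hfar⟩ := exists_far_of_lt_swallowingTime hc ω hx' hg hlt
    obtain ⟨n₀, hn₀⟩ := exists_nat_one_div_lt hm
    refine tendsto_const_nhds.congr' ?_
    filter_upwards [eventually_ge_atTop n₀] with n hn
    have hnm : 1 / (n + 1 : ℝ) ≤ m := by
      have h1 : (1 : ℝ) / (n + 1) ≤ 1 / (n₀ + 1) :=
        one_div_le_one_div_of_le (by positivity) (by exact_mod_cast Nat.succ_le_succ hn)
      linarith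
    have heq := truncFlow_eq_re hc ω hg hlt n hnm hfar ⟨t.coe_nonneg, le_rfl⟩
    simp only at heq
    rw [heq, map_eq_of_isSolution (hc ω) hg hlt]
  · have hlt : ¬ (t : WithTop ℝ≥0) < swallowingTime (W ω) x := hω
    simp only [hG, if_neg hω, if_neg hlt]
    exact tendsto_const_nhds

end Parametrised

end Loewner

end Literature.Probability.RandomPlanarGeometry
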